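import Mathlib
import Summits.ResolutionOfSingularities.ResolutionOfSingularities.Theorems.RadicialJungCleanModelsContactChain
import Literature.AlgebraicGeometry.Resolution.BlowupSequences
import Literature.AlgebraicGeometry.Resolution.BlowupsIntegral
import Literature.AlgebraicGeometry.Resolution.BlowupsProperProofs
import Literature.AlgebraicGeometry.Resolution.BlowupAxialPoint
import Literature.AlgebraicGeometry.Resolution.PointCentrePermissible
import HarnessLib

/-!
# Route `RadicialJung`, crux `CleanModels` (stmt-ResolutionOfSingularities-15917), line `Sketch` rev 20, stub 4e
# `stub_cleanPrincipalization3`: toward L7b — CHAINS OF POINT BLOWING UPS FOLLOWING A CURVE EXIST, TO ANY LENGTH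

Memo `Cruxes/CleanModels/Lines/Sketch-memo-4e-cleanPermissible.md` rev 11.3 §2.3 `(μ,1)` (a) / rev 10 §3 / §4.1 (O8).  Companion of
`ContactChain.lean` (✓ p691777): on a regular INTEGRAL locally Noetherian `X₀`, through a closed point `x₀` (with `dim 𝒪_{X₀,x₀} = 3`) of a
regular curve `C₀`, there is for every `n` a chain `IsPointChainAlong σ C₀ C x n` of `n` point blowing ups following the curve, ending at a
CLOSED point `x` over `x₀`, with `X` integral and locally Noetherian — built from the chosen blowing ups `blowup` (`BlowupSequences.lean`),
their integrality (`IsBlowup.isIntegral`), properness (`IsBlowup.isProper` ⇒ locally Noetherian), the regular point subscheme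
(`isRegular_subscheme_vanishingIdeal_singleton`), the point of the strict transform over `x` (the iso `C̃ ≅ C` over `X`,
`exists_iso_subscheme_strictTransformIdeal_of_transverse`) and its closedness (`IsBlowup.isClosed_singleton_of_ringKrullDim_eq`, the local
dimension staying `3`).
* `data_along_pointChain` — regularity, the curve property, `x ∈ C` and `dim 𝒪_{X,x} = 3` propagate along any chain.
* `exists_pointChainAlong` — existence to any length.
With `exists_contact_normalForm` (✓ p691423), `contact_along_pointChain` (✓ p691777) and `cleanPermissibleAt_of_chargedLanding` this is L7b
phase 1 for one old component not containing the curve, up to the function-field bookkeeping of the clean line.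

Honest framing: OURS, assembly; nothing here proves resolution in characteristic `p` or any case of `CleanModels`.
-/

noncomputable section

set_option linter.dupNamespace false -- mandated namespace of this single-conjunct summit

open CategoryTheory AlgebraicGeometry TopologicalSpace IsLocalRing
open Literature.AlgebraicGeometry.Resolution
open Scheme.IdealSheafData

universe u

namespace Summit.ResolutionOfSingularities.ResolutionOfSingularities.Theorems.RadicialJung.CleanModels

/-- **The data propagate along a chain**: regularity of the ambient scheme, the regular-curve property of the strict transform at each of its
points, `x ∈ C`, and `dim 𝒪_{X,x} = 3`. [cite: CossartPiltant2008, Prop. 4.4 (proof, p. 10)] -/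
theorem data_along_pointChain {X₀ X : Scheme.{u}} {σ : X ⟶ X₀} {C₀ : Closeds X₀} {C : Closeds X} {x : X} {n : ℕ}
    (h : IsPointChainAlong σ C₀ C x n) [IsLocallyNoetherian X₀] [IsLocallyNoetherian X] (hX₀ : Scheme.IsRegular X₀)
    (hC₀reg : ∀ y ∈ (C₀ : Set X₀), ∃ c : Fin 2 → X₀.presheaf.stalk y,
      IsRsopPart c ∧ Ideal.span (Set.range c) = stalkIdeal (vanishingIdeal C₀) y)
    (hxC₀ : σ x ∈ (C₀ : Set X₀)) (hdim₀ : ringKrullDim (X₀.presheaf.stalk (σ x)) = 3) :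
    Scheme.IsRegular X ∧
    (∀ y ∈ (C : Set X), ∃ c : Fin 2 → X.presheaf.stalk y, IsRsopPart c ∧ Ideal.span (Set.range c) = stalkIdeal (vanishingIdeal C) y) ∧
    x ∈ (C : Set X) ∧ ringKrullDim (X.presheaf.stalk x) = 3 := by
  induction h with
  | nil C₀ x₀ => exact ⟨hX₀, hC₀reg, hxC₀, hdim₀⟩
  | cons σ C₀ C n τ x' hx hchain hYreg hτ hx' ih =>
    obtain ⟨hX, hCreg, hxC, hdim⟩ := ih hC₀reg hxC₀ hdim₀
    obtain ⟨hX', hC'reg, hdim'⟩ := strictTransform_curve_data_of_isBlowup_point hX hx hYreg hτ hCreg hxC hdim hx'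
    exact ⟨hX', hC'reg, hx', hdim'⟩

/-- The stalks of the zero ideal sheaf vanish (local copy). [folklore] -/
private theorem stalkIdeal_bot' {X : Scheme.{u}} (x : X) : stalkIdeal (⊥ : X.IdealSheafData) x = ⊥ := by
  obtain ⟨U, hU, hxU, -⟩ := exists_isAffineOpen_mem_and_subset (X := X) (x := x) (U := ⊤) (Opens.mem_top _)
  rw [stalkIdeal_eq_map_germ ⊥ ⟨U, hU⟩ hxU, Scheme.IdealSheafData.ideal_bot, Pi.bot_apply, Ideal.map_bot]

/-- **One more step exists**: over a closed point `x` (with `dim 𝒪_{X,x} = 3`) of a regular curve `C` on a regular integral locally Noetherian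
`X`, the chosen blowing up `τ : Bl_x X → X` is the blowing up of a regular point subscheme, `Bl_x X` is integral and locally Noetherian, and the
strict transform `C̃` has a CLOSED point `x'` over `x`. [cite: StacksProject, Tag 080E] [cite: CossartPiltant2008, Prop. 4.4 (proof, p. 10)] -/
theorem exists_point_strictTransform_over {X : Scheme.{u}} [IsIntegral X] [IsLocallyNoetherian X] (hX : Scheme.IsRegular X)
    {C : Closeds X} (hCreg : ∀ y ∈ (C : Set X), ∃ c : Fin 2 → X.presheaf.stalk y,
      IsRsopPart c ∧ Ideal.span (Set.range c) = stalkIdeal (vanishingIdeal C) y)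
    {x : X} (hx : IsClosed ({x} : Set X)) (hxC : x ∈ (C : Set X)) (hdim : ringKrullDim (X.presheaf.stalk x) = 3) :
    IsIntegral (blowup (vanishingIdeal (⟨{x}, hx⟩ : Closeds X))) ∧
    IsLocallyNoetherian (blowup (vanishingIdeal (⟨{x}, hx⟩ : Closeds X))) ∧
    ∃ x' : blowup (vanishingIdeal (⟨{x}, hx⟩ : Closeds X)),
      blowup.π (vanishingIdeal (⟨{x}, hx⟩ : Closeds X)) x' = x ∧
      x' ∈ closure ((blowup.π (vanishingIdeal (⟨{x}, hx⟩ : Closeds X))) ⁻¹' ((C : Set X) \ {x})) ∧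
      IsClosed ({x'} : Set (blowup (vanishingIdeal (⟨{x}, hx⟩ : Closeds X)))) := by
  set Y : Closeds X := ⟨{x}, hx⟩
  set τ := blowup.π (vanishingIdeal Y)
  have hτ : IsBlowup τ (vanishingIdeal Y) := blowup.isBlowup _
  -- the centre ideal is nonzero: it contains a regular parameter at `x`
  have hYbot : vanishingIdeal Y ≠ ⊥ := by
    intro hbot
    obtain ⟨c, hc, hspan⟩ := hCreg x hxC
    have hPle : stalkIdeal (vanishingIdeal C) x ≤ maximalIdeal _ :=
      (mem_support_iff_stalkIdeal_le _ _).mp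
        (by rw [← SetLike.mem_coe, Scheme.IdealSheafData.coe_support_vanishingIdeal]; exact hxC)
    have h0 : c 0 ∈ stalkIdeal (vanishingIdeal Y) x := by
      rw [stalkIdeal_vanishingIdeal_singleton hx]
      exact hPle (hspan ▸ Ideal.subset_span ⟨0, rfl⟩)
    rw [hbot, stalkIdeal_bot', Ideal.mem_bot] at h0
    exact hc.ne_zero 0 h0
  haveI hint : IsIntegral (blowup (vanishingIdeal Y)) := hτ.isIntegral hYbot
  haveI : IsProper τ := hτ.isProper
  haveI hnoeth : IsLocallyNoetherian (blowup (vanishingIdeal Y)) := LocallyOfFiniteType.isLocallyNoetherian τ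
  refine ⟨hint, hnoeth, ?_⟩
  -- transversality and dimension hypotheses in the form of the tree lemmas
  have hPle : stalkIdeal (vanishingIdeal C) x ≤ maximalIdeal _ :=
    (mem_support_iff_stalkIdeal_le _ _).mp
      (by rw [← SetLike.mem_coe, Scheme.IdealSheafData.coe_support_vanishingIdeal]; exact hxC)
  have htr : ∀ y ∈ (C : Set X) ∩ Y, stalkIdeal (vanishingIdeal C) y ⊔ stalkIdeal (vanishingIdeal Y) y = maximalIdeal _ := by
    rintro y ⟨-, hy⟩
    have hy' : y = x := hy
    subst hy'
    rw [stalkIdeal_vanishingIdeal_singleton hx]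
    exact sup_eq_right.mpr hPle
  have hdim' : ∀ y ∈ (C : Set X) ∩ Y, ringKrullDim (X.presheaf.stalk y) = 3 := by
    rintro y ⟨-, hy⟩
    have hy' : y = x := hy
    subst hy'
    exact hdim
  -- the point of the strict transform over `x`, through `C̃ ≅ C` over `X`
  obtain ⟨e, he⟩ := exists_iso_subscheme_strictTransformIdeal_of_transverse hτ hCreg htr hdim'
  obtain ⟨v, hv⟩ : x ∈ Set.range (vanishingIdeal C).subschemeι := by
    rw [range_subschemeι_vanishingIdeal]; exact hxC
  set x' : blowup (vanishingIdeal Y) := (strictTransformIdeal τ (vanishingIdeal Y) (vanishingIdeal C)).subschemeι (e.inv v) with hx'def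
  have hτx' : τ x' = x := by
    have h1 : τ x' = (vanishingIdeal C).subschemeι (e.hom (e.inv v)) := by
      rw [hx'def, ← Scheme.Hom.comp_apply, ← he, Scheme.Hom.comp_apply]
    have h2 : e.hom (e.inv v) = v := by
      rw [← Scheme.Hom.comp_apply, e.inv_hom_id]
      rfl
    rw [h1, h2, hv]
  have hx'mem : x' ∈ closure (τ ⁻¹' ((C : Set X) \ {x})) := by
    have h1 : x' ∈ ((strictTransformIdeal τ (vanishingIdeal Y) (vanishingIdeal C)).support : Set _) := by
      rw [← range_subschemeι]; exact Set.mem_range_self _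
    rw [support_strictTransformIdeal_eq_closure, Scheme.IdealSheafData.coe_support_vanishingIdeal,
      Scheme.IdealSheafData.coe_support_vanishingIdeal] at h1
    exact h1
  refine ⟨x', hτx', hx'mem, ?_⟩
  -- closedness: same local dimension as `x`
  have hxclosed : IsClosed ({τ x'} : Set X) := by rw [hτx']; exact hx
  have hYreg : Scheme.IsRegular (vanishingIdeal (⟨{τ x'}, hxclosed⟩ : Closeds X)).subscheme :=
    isRegular_subscheme_vanishingIdeal_singleton hxclosed
  have hτ' : IsBlowup τ (vanishingIdeal (⟨{τ x'}, hxclosed⟩ : Closeds X)) := by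
    have : (⟨{τ x'}, hxclosed⟩ : Closeds X) = Y :=
      Closeds.ext (by change ({τ x'} : Set X) = ({x} : Set X); rw [hτx'])
    rw [this]; exact hτ
  have hx'mem' : x' ∈ closure (τ ⁻¹' ((C : Set X) \ {τ x'})) := by rw [hτx']; exact hx'mem
  have hxC' : τ x' ∈ (C : Set X) := by rw [hτx']; exact hxC
  have hdimx : ringKrullDim (X.presheaf.stalk (τ x')) = 3 := by rw [hτx']; exact hdim
  obtain ⟨-, -, hdim3⟩ := strictTransform_curve_data_of_isBlowup_point hX hxclosed hYreg hτ' hCreg hxC' hdimx hx'mem'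
  exact hτ.isClosed_singleton_of_ringKrullDim_eq hxclosed (by rw [hdim3, hdimx])

/-- **Chains of point blowing ups following a regular curve exist, to any length**, on a regular integral locally Noetherian `X₀`, from a
closed point `x₀ ∈ C₀` with `dim 𝒪_{X₀,x₀} = 3`; the end scheme is integral and locally Noetherian, the end point is closed and lies over `x₀`.
[cite: CossartPiltant2008, Prop. 4.4 (proof, p. 10)] [cite: CossartJannsenSaito2020, proof of Thm. 6.28, Step 5] -/
theorem exists_pointChainAlong {X₀ : Scheme.{u}} [IsIntegral X₀] [IsLocallyNoetherian X₀] (hX₀ : Scheme.IsRegular X₀)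
    {C₀ : Closeds X₀} (hC₀reg : ∀ y ∈ (C₀ : Set X₀), ∃ c : Fin 2 → X₀.presheaf.stalk y,
      IsRsopPart c ∧ Ideal.span (Set.range c) = stalkIdeal (vanishingIdeal C₀) y)
    {x₀ : X₀} (hx₀ : IsClosed ({x₀} : Set X₀)) (hx₀C : x₀ ∈ (C₀ : Set X₀)) (hdim₀ : ringKrullDim (X₀.presheaf.stalk x₀) = 3)
    (n : ℕ) :
    ∃ (X : Scheme.{u}) (_ : IsIntegral X) (_ : IsLocallyNoetherian X) (σ : X ⟶ X₀) (C : Closeds X) (x : X),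
      IsPointChainAlong σ C₀ C x n ∧ σ x = x₀ ∧ IsClosed ({x} : Set X) := by
  induction n with
  | zero => exact ⟨X₀, inferInstance, inferInstance, 𝟙 X₀, C₀, x₀, IsPointChainAlong.nil C₀ x₀, rfl, hx₀⟩
  | succ n ih =>
    obtain ⟨X, hXint, hXnoeth, σ, C, x, hchain, hσx, hxcl⟩ := ih
    have hxC₀ : σ x ∈ (C₀ : Set X₀) := by rw [hσx]; exact hx₀C
    have hdimσ : ringKrullDim (X₀.presheaf.stalk (σ x)) = 3 := by rw [hσx]; exact hdim₀
    obtain ⟨hX, hCreg, hxC, hdim⟩ := data_along_pointChain hchain hX₀ hC₀reg hxC₀ hdimσ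
    obtain ⟨hint, hnoeth, x', hτx', hx'mem, hx'cl⟩ := exists_point_strictTransform_over hX hCreg hxcl hxC hdim
    -- re-index everything at `τ x'` (`= x`)
    set τ := blowup.π (vanishingIdeal (⟨{x}, hxcl⟩ : Closeds X)) with hτdef
    have hxcl' : IsClosed ({τ x'} : Set X) := by rw [hτx']; exact hxcl
    have hYeq : (⟨{τ x'}, hxcl'⟩ : Closeds X) = ⟨{x}, hxcl⟩ :=
      Closeds.ext (by change ({τ x'} : Set X) = ({x} : Set X); rw [hτx'])
    have hτ : IsBlowup τ (vanishingIdeal (⟨{τ x'}, hxcl'⟩ : Closeds X)) := by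
      rw [hYeq]; exact blowup.isBlowup _
    have hchain' : IsPointChainAlong σ C₀ C (τ x') n := by rw [hτx']; exact hchain
    have hx'mem' : x' ∈ closure (τ ⁻¹' ((C : Set X) \ {τ x'})) := by rw [hτx']; exact hx'mem
    refine ⟨_, hint, hnoeth, τ ≫ σ, _, x',
      IsPointChainAlong.cons σ C₀ C n τ x' hxcl' hchain' (isRegular_subscheme_vanishingIdeal_singleton hxcl') hτ hx'mem', ?_, hx'cl⟩
    rw [Scheme.Hom.comp_apply, hτx']
    exact hσx

end Summit.ResolutionOfSingularities.ResolutionOfSingularities.Theorems.RadicialJung.CleanModels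

end
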